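import Summits.AtomisticToContinuum.Crystallization.Theorems.OverbindingBudgetAffineCompressedCutSeedTwo

/-!
# Overbinding budget — compressed cut: R3 «Stack» I — NEIGHBOUR LABELS, COPY AGREEMENT of adjacent sites, TYPE FROM COPY

Record: route `OverbindingBudget`, crux `RobustDefectLimitWindows` (stmt-AtomisticToContinuum-31280); open leaf NS♭₂ ⟸ 79K ⟸ LR(r₁)
(critic row 1428 (b): R1 «ExactStep» → R2 «Seed» → R3 «Stack» → R4 «LR(r₁)»).  This file is the first half of R3: the LOCAL and EXACT form of the
"class recursion" of row 1428 — adjacent established sites of one layer carry the SAME aligned copy, and the copy determines the type.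

WHAT THIS FILE PROVES (potential-free, sorry-free; every constant symbolic except the record reach `3/2 + 1/450` and tolerance `10⁻⁴`).
* §0 bookkeeping: `tsub_tadd_eq`, `lnorm_tadd_le`, `lnorm_hex`, `inLayer_tadd`, the general child position bound `child_position_gen`
  (`D + 10⁻⁴·nn_j + τ·‖v‖`, any pattern point `v`).
* §1 ★ `label_mem` — NEIGHBOUR LABEL LEMMA: if the established `j` (label `λ`) registers a site `m` through a first-shell point charted to `mv c`, and `m`
  lies within the exhaustiveness reach of the established `j′` (label `λ′`, copy `C′`), then — provided the two position bounds resolve against the base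
  frame's lower bound `β` at the granularity `g` of the candidate set (`18·S² < g·β²`) — the label difference `λ + c − λ′` is a MEMBER OF `C′` and is the
  chart image of the point of `j′` registering `m`.  Mechanism: exhaustiveness at `j′`, the two `child_position` bounds, `β‖z‖ ≤ ‖B z‖`, integrality.
* §2 ★★ `copy_eq_of_adjacent` — two established sites of one layer (labels differing by a basal vector `e ∈ hexL`) with copies among the four aligned
  copies `F⁺, F⁻, H, H′` carry the SAME copy: the upper and the lower cap child of `j` adjacent to `j′` pin, by `label_mem`, an upper and a lower cap
  vector of `C′`, and the pair (upper cap type, lower cap type) determines the copy (`pin_table`, `gran_table`, decided; granularity `g = 6`).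
* §3 ★ `type_hcp_of_copy` / `type_fcc_of_copy` — a pattern carried onto `H` or `H′` is the hcp pattern, onto `F⁺` or `F⁻` the fcc pattern
  (central symmetry is transported by charts: `carries_symm_of_listed`, `listed_symm_of_carries`; `symm_fcc`, `not_symm_hcp` decided).

Deps: `…CompressedCutSeedTwo`.  No `instance`, no `notation`, no `set_option`, no new axioms, 0 sorry.
-/

namespace Summit.AtomisticToContinuum.Crystallization.Theorems.OverbindingBudgetAffineCompressedCutStack

open Literature.Geometry.DiscreteGeometry (nearestDist nearestDist_nonneg nearestDist_le_dist fccTwoShellPattern hcpTwoShellPattern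
  norm_le_sqrt_two_of_mem_twoShellPattern)
open Summit.AtomisticToContinuum.Crystallization.Theorems.OverbindingBudgetAffineCompressedCutKernel (T3 tsub tadd tneg tsq thsum fccL hcpL fccNegL
  hcpAltL hexL capL mem_capL)
open Summit.AtomisticToContinuum.Crystallization.Theorems.OverbindingBudgetAffineCompressedCutCharts (mv mv_tadd mv_tsub mv_tneg mv_injective norm_mv_sq
  norm_mv_eq_one_iff Carries ListedBy listedBy_fcc listedBy_hcp)
open Summit.AtomisticToContinuum.Crystallization.Theorems.OverbindingBudgetAffineCompressedCutEstablish (Estab child_position link_nonneg)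
open Summit.AtomisticToContinuum.Crystallization.Theorems.OverbindingBudgetAffineCompressedCutSeed (InLayer lnorm hexL_facts)

variable {N : ℕ}

/-! ## §0  Bookkeeping -/

/-- `(λ + c) − λ′ = c − (λ′ − λ)`. [this file] -/
theorem tsub_tadd_eq (l c l' : T3) : tsub (tadd l c) l' = tsub c (tsub l' l) := by
  obtain ⟨a₁, a₂, a₃⟩ := l
  obtain ⟨b₁, b₂, b₃⟩ := c
  obtain ⟨c₁, c₂, c₃⟩ := l'
  simp only [tsub, tadd, Prod.mk.injEq]
  omega

/-- `(λ + (x + e)) − (λ + x) = e`. [this file] -/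
theorem tsub_tadd_tadd (l x e : T3) : tsub (tadd l (tadd x e)) (tadd l x) = e := by
  obtain ⟨a₁, a₂, a₃⟩ := l
  obtain ⟨b₁, b₂, b₃⟩ := x
  obtain ⟨c₁, c₂, c₃⟩ := e
  simp only [tsub, tadd, Prod.mk.injEq]
  omega

/-- `((λ + c) + x) − (λ + x) = c`. [this file] -/
theorem tsub_tadd_tadd' (l c x : T3) : tsub (tadd (tadd l c) x) (tadd l x) = c := by
  obtain ⟨a₁, a₂, a₃⟩ := l
  obtain ⟨b₁, b₂, b₃⟩ := c
  obtain ⟨c₁, c₂, c₃⟩ := x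
  simp only [tsub, tadd, Prod.mk.injEq]
  omega

/-- `((λ + c) + x) − (λ + (x + e)) = c − e`. [this file] -/
theorem tsub_tadd_tadd'' (l c x e : T3) : tsub (tadd (tadd l c) x) (tadd l (tadd x e)) = tsub c e := by
  obtain ⟨a₁, a₂, a₃⟩ := l
  obtain ⟨b₁, b₂, b₃⟩ := c
  obtain ⟨c₁, c₂, c₃⟩ := x
  obtain ⟨d₁, d₂, d₃⟩ := e
  simp only [tsub, tadd, Prod.mk.injEq]
  omega

/-- Subadditivity of the layer norm. [this file] -/
theorem lnorm_tadd_le (x e : T3) : lnorm (tadd x e) ≤ lnorm x + lnorm e := by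
  obtain ⟨a₁, a₂, a₃⟩ := x
  obtain ⟨b₁, b₂, b₃⟩ := e
  simp only [lnorm, tadd]
  have h1 := abs_add_le a₁ b₁
  have h2 := abs_add_le a₂ b₂
  have h3 := abs_add_le a₃ b₃
  linarith

/-- The basal vectors have layer norm `6`. [this file] -/
theorem lnorm_hex : ∀ h ∈ hexL, lnorm h = 6 := by decide

/-- The layer lattice is closed under addition. [this file] -/
theorem inLayer_tadd {x e : T3} (hx : InLayer x) (he : InLayer e) : InLayer (tadd x e) := by
  obtain ⟨hs, h1, h2⟩ := hx
  obtain ⟨hs', h1', h2'⟩ := he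
  refine ⟨?_, ?_, ?_⟩
  · simp only [tadd]; linarith
  · simp only [tadd]; exact dvd_add h1 h1'
  · simp only [tadd]; exact dvd_add h2 h2'

/-- **Child position, any pattern point.**  As `…Establish.child_position` without `‖v‖ = 1`: the site registered through `v` sits at label `λ + x`
within `D + 10⁻⁴·nn_j + τ·‖v‖`. [this file] -/
theorem child_position_gen {y : Fin N → EuclideanSpace ℝ (Fin 3)} {A : Fin N → (EuclideanSpace ℝ (Fin 3) →ₗ[ℝ] EuclideanSpace ℝ (Fin 3))}
    {P : Fin N → Finset (EuclideanSpace ℝ (Fin 3))} {B : EuclideanSpace ℝ (Fin 3) →ₗ[ℝ] EuclideanSpace ℝ (Fin 3)} {i j k : Fin N}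
    {M : EuclideanSpace ℝ (Fin 3) →ₗᵢ[ℝ] EuclideanSpace ℝ (Fin 3)} {C : List T3} {lam : T3} {τ D : ℝ} (hE : Estab y A P B i j M C lam τ D)
    {fj : EuclideanSpace ℝ (Fin 3) → EuclideanSpace ℝ (Fin 3)}
    (hfj : ∀ v ∈ P j, fj v ∈ Set.range y ∧ dist (fj v) (y j + nearestDist y j • A j v) ≤ 1 / 10 ^ 4 * nearestDist y j)
    {v : EuclideanSpace ℝ (Fin 3)} (hv : v ∈ P j) {x : T3} (hMv : M v = mv x) (hk : fj v = y k) :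
    ‖y k - y i - B (mv (tadd lam x))‖ ≤ D + 1 / 10 ^ 4 * nearestDist y j + τ * ‖v‖ := by
  have h1 := (hfj v hv).2
  rw [hk, dist_eq_norm] at h1
  have h2 := hE.2.1 v
  rw [hMv] at h2
  have h3 := hE.2.2
  have e : y k - y i - B (mv (tadd lam x)) =
      (y k - (y j + nearestDist y j • A j v)) + (nearestDist y j • A j v - B (mv x)) + (y j - y i - B (mv lam)) := by
    rw [mv_tadd, map_add]; abel
  rw [e]
  have h4 := norm_add_le ((y k - (y j + nearestDist y j • A j v)) + (nearestDist y j • A j v - B (mv x))) (y j - y i - B (mv lam))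
  have h5 := norm_add_le (y k - (y j + nearestDist y j • A j v)) (nearestDist y j • A j v - B (mv x))
  linarith

/-! ## §1  The neighbour label lemma -/

/-- ★ **NEIGHBOUR LABEL.**  `j` established (label `λ`, copy `C`) registers `m` through the first-shell point `v` charted to `mv c`; `j′` established (label
`λ′`, copy `C′`); `m ≠ j′` within the exhaustiveness reach of `j′`; every member of `C′` other than `t = λ + c − λ′` is at squared model distance
`≥ g` (in units `1/18`) from `t`; and the position bounds resolve: `18·S² < g·β²`, `S = (D + 10⁻⁴nn_j + τ) + (D′ + 10⁻⁴nn_{j′} + √2·τ′)`.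
THEN `t ∈ C′`, and the point of `j′` registering `m` is charted to `mv t`. [this file] -/
theorem label_mem {y : Fin N → EuclideanSpace ℝ (Fin 3)} {r : ℝ} {i j j' m : Fin N}
    {A : Fin N → (EuclideanSpace ℝ (Fin 3) →ₗ[ℝ] EuclideanSpace ℝ (Fin 3))} {P : Fin N → Finset (EuclideanSpace ℝ (Fin 3))}
    {f : Fin N → EuclideanSpace ℝ (Fin 3) → EuclideanSpace ℝ (Fin 3)} {B : EuclideanSpace ℝ (Fin 3) →ₗ[ℝ] EuclideanSpace ℝ (Fin 3)} {β : ℝ}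
    (hP : ∀ j, dist (y j) (y i) ≤ r → (P j = fccTwoShellPattern ∨ P j = hcpTwoShellPattern))
    (hf : ∀ j, dist (y j) (y i) ≤ r → ∀ v ∈ P j, f j v ∈ Set.range y ∧ dist (f j v) (y j + nearestDist y j • A j v) ≤ 1 / 10 ^ 4 * nearestDist y j)
    (hex : ∀ j, dist (y j) (y i) ≤ r → ∀ m, m ≠ j → dist (y m) (y j) ≤ (3 / 2 + 1 / 450) * nearestDist y j → ∃ v ∈ P j, f j v = y m)
    (hj : dist (y j) (y i) ≤ r) (hj' : dist (y j') (y i) ≤ r) (hB : ∀ z, β * ‖z‖ ≤ ‖B z‖) (hβ : 0 < β)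
    {M M' : EuclideanSpace ℝ (Fin 3) →ₗᵢ[ℝ] EuclideanSpace ℝ (Fin 3)} {C C' : List T3} {lam lam' c : T3} {τ τ' D D' : ℝ}
    (hE : Estab y A P B i j M C lam τ D) (hE' : Estab y A P B i j' M' C' lam' τ' D')
    {v : EuclideanSpace ℝ (Fin 3)} (hv : v ∈ P j) (hv1 : ‖v‖ = 1) (hMv : M v = mv c) (hm : f j v = y m) (hmj' : m ≠ j')
    (hreach : dist (y m) (y j') ≤ (3 / 2 + 1 / 450) * nearestDist y j')
    {g : ℤ} (hgran : ∀ V ∈ C', V ≠ tsub (tadd lam c) lam' → g ≤ tsq (tsub (tsub (tadd lam c) lam') V))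
    (hgap : 18 * ((D + 1 / 10 ^ 4 * nearestDist y j + τ) + (D' + 1 / 10 ^ 4 * nearestDist y j' + Real.sqrt 2 * τ')) ^ 2 < g * β ^ 2) :
    tsub (tadd lam c) lam' ∈ C' ∧ ∃ v' ∈ P j', f j' v' = y m ∧ M' v' = mv (tsub (tadd lam c) lam') := by
  have hposm := child_position hE (hf j hj) hv hv1 hMv hm
  obtain ⟨v', hv', hfv'⟩ := hex j' hj' m hmj' hreach
  obtain ⟨V, hV, hMV⟩ := hE'.1.1 v' hv'
  have hposm' := child_position_gen hE' (hf j' hj') hv' hMV hfv'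
  have hv'2 : ‖v'‖ ≤ Real.sqrt 2 := norm_le_sqrt_two_of_mem_twoShellPattern (hP j' hj') hv'
  have hτ' : 0 ≤ τ' := link_nonneg hE'.2.1
  have hb : τ' * ‖v'‖ ≤ Real.sqrt 2 * τ' := by
    rw [mul_comm]
    exact mul_le_mul_of_nonneg_right hv'2 hτ'
  have hw : ‖B (mv (tsub (tsub (tadd lam c) lam') V))‖ ≤
      (D + 1 / 10 ^ 4 * nearestDist y j + τ) + (D' + 1 / 10 ^ 4 * nearestDist y j' + Real.sqrt 2 * τ') := by
    have e : B (mv (tsub (tsub (tadd lam c) lam') V)) = (y m - y i - B (mv (tadd lam' V))) - (y m - y i - B (mv (tadd lam c))) := by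
      rw [mv_tsub, mv_tsub, mv_tadd, mv_tadd, map_sub, map_sub, map_add, map_add]; abel
    rw [e]
    exact (norm_sub_le _ _).trans (by linarith)
  have hVt : V = tsub (tadd lam c) lam' := by
    by_contra hne
    have h1 : (g : ℝ) ≤ tsq (tsub (tsub (tadd lam c) lam') V) := by exact_mod_cast hgran V hV hne
    have h2 := norm_mv_sq (tsub (tsub (tadd lam c) lam') V)
    have h4 : β * ‖mv (tsub (tsub (tadd lam c) lam') V)‖ ≤
        (D + 1 / 10 ^ 4 * nearestDist y j + τ) + (D' + 1 / 10 ^ 4 * nearestDist y j' + Real.sqrt 2 * τ') := (hB _).trans hw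
    have h5 : 0 ≤ β * ‖mv (tsub (tsub (tadd lam c) lam') V)‖ := mul_nonneg hβ.le (norm_nonneg _)
    have h6 : (β * ‖mv (tsub (tsub (tadd lam c) lam') V)‖) ^ 2 ≤
        ((D + 1 / 10 ^ 4 * nearestDist y j + τ) + (D' + 1 / 10 ^ 4 * nearestDist y j' + Real.sqrt 2 * τ')) ^ 2 := by
      nlinarith
    rw [mul_pow, h2] at h6
    nlinarith [sq_nonneg β]
  refine ⟨hVt ▸ hV, v', hv', hfv', by rw [hMV, hVt]⟩

/-! ## §2  Copy agreement of adjacent established sites -/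

/-- **Granularity table** (by `decide`): a first-shell vector `c − e` (`c` a first-shell member of an aligned copy, `e` basal, `c − e` first-shell) is at
squared distance `≥ 6` from every OTHER member of every aligned copy. [this file] -/
theorem gran_table : ∀ C ∈ [fccL, fccNegL, hcpL, hcpAltL], ∀ c ∈ C, tsq c = 18 → ∀ e ∈ hexL, tsq (tsub c e) = 18 →
    ∀ C' ∈ [fccL, fccNegL, hcpL, hcpAltL], ∀ V ∈ C', V ≠ tsub c e → 6 ≤ tsq (tsub (tsub c e) V) := by
  decide +kernel

/-- **Pinning table** (by `decide`): for every aligned copy `C` and basal vector `e` there are an upper cap vector `c⁺` and a lower cap vector `c⁻` of `C`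
with `c± − e` first-shell such that an aligned copy containing both `c⁺ − e` and `c⁻ − e` IS `C`. [this file] -/
theorem pin_table : ∀ C ∈ [fccL, fccNegL, hcpL, hcpAltL], ∀ e ∈ hexL,
    ∃ cp ∈ capL C 1, ∃ cm ∈ capL C (-1), tsq (tsub cp e) = 18 ∧ tsq (tsub cm e) = 18 ∧
      ∀ C' ∈ [fccL, fccNegL, hcpL, hcpAltL], tsub cp e ∈ C' → tsub cm e ∈ C' → C' = C := by
  decide +kernel

/-- **A cap child pins a cap vector of the neighbour's copy.**  `j, j′` established in one layer (`λ′ − λ = e`), `c ∈ C` a first-shell vector with `c − e`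
first-shell and `6`-granular against `C′`; base frame with `β‖z‖ ≤ ‖B z‖ ≤ γ‖z‖`; reach `γ + (D + 10⁻⁴nn_j + τ) + D′ ≤ (3/2 + 1/450)·nn_{j′}` and resolution
`18·S² < 6·β²`.  Then `c − e ∈ C′`. [this file] -/
theorem cap_child_label {y : Fin N → EuclideanSpace ℝ (Fin 3)} {r : ℝ} {i j j' : Fin N}
    {A : Fin N → (EuclideanSpace ℝ (Fin 3) →ₗ[ℝ] EuclideanSpace ℝ (Fin 3))} {P : Fin N → Finset (EuclideanSpace ℝ (Fin 3))}
    {f : Fin N → EuclideanSpace ℝ (Fin 3) → EuclideanSpace ℝ (Fin 3)} {B : EuclideanSpace ℝ (Fin 3) →ₗ[ℝ] EuclideanSpace ℝ (Fin 3)} {β γ : ℝ}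
    (hP : ∀ j, dist (y j) (y i) ≤ r → (P j = fccTwoShellPattern ∨ P j = hcpTwoShellPattern))
    (hf : ∀ j, dist (y j) (y i) ≤ r → ∀ v ∈ P j, f j v ∈ Set.range y ∧ dist (f j v) (y j + nearestDist y j • A j v) ≤ 1 / 10 ^ 4 * nearestDist y j)
    (hex : ∀ j, dist (y j) (y i) ≤ r → ∀ m, m ≠ j → dist (y m) (y j) ≤ (3 / 2 + 1 / 450) * nearestDist y j → ∃ v ∈ P j, f j v = y m)
    (hj : dist (y j) (y i) ≤ r) (hj' : dist (y j') (y i) ≤ r) (hB : ∀ z, β * ‖z‖ ≤ ‖B z‖) (hβ : 0 < β) (hBup : ∀ z, ‖B z‖ ≤ γ * ‖z‖)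
    {M M' : EuclideanSpace ℝ (Fin 3) →ₗᵢ[ℝ] EuclideanSpace ℝ (Fin 3)} {C C' : List T3} {lam lam' : T3} {τ τ' D D' : ℝ}
    (hE : Estab y A P B i j M C lam τ D) (hE' : Estab y A P B i j' M' C' lam' τ' D')
    {c : T3} (hcC : c ∈ C) (hc18 : tsq c = 18) (hce : tsq (tsub c (tsub lam' lam)) = 18)
    (hgran : ∀ V ∈ C', V ≠ tsub c (tsub lam' lam) → 6 ≤ tsq (tsub (tsub c (tsub lam' lam)) V))
    (hreach : γ + (D + 1 / 10 ^ 4 * nearestDist y j + τ) + D' ≤ (3 / 2 + 1 / 450) * nearestDist y j')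
    (hgap : 18 * ((D + 1 / 10 ^ 4 * nearestDist y j + τ) + (D' + 1 / 10 ^ 4 * nearestDist y j' + Real.sqrt 2 * τ')) ^ 2 < 6 * β ^ 2) :
    tsub c (tsub lam' lam) ∈ C' := by
  obtain ⟨v, hv, hMv⟩ := hE.1.2 c hcC
  have hv1 : ‖v‖ = 1 := by
    have h := (norm_mv_eq_one_iff c).2 hc18
    rwa [← hMv, M.norm_map] at h
  obtain ⟨m, hm⟩ := (hf j hj v hv).1
  have hposm := child_position hE (hf j hj) hv hv1 hMv hm.symm
  have ht : tsub (tadd lam c) lam' = tsub c (tsub lam' lam) := tsub_tadd_eq lam c lam'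
  have hD' : 0 ≤ D' := (norm_nonneg _).trans hE'.2.2
  have hτ' : 0 ≤ τ' := link_nonneg hE'.2.1
  have hnn' := nearestDist_nonneg y j'
  have hst : 0 ≤ Real.sqrt 2 * τ' := mul_nonneg (Real.sqrt_nonneg 2) hτ'
  have hSβ : (D + 1 / 10 ^ 4 * nearestDist y j + τ) + D' < β := by
    by_contra h
    have h := not_lt.1 h
    have h0 : β ≤ (D + 1 / 10 ^ 4 * nearestDist y j + τ) + (D' + 1 / 10 ^ 4 * nearestDist y j' + Real.sqrt 2 * τ') := by nlinarith
    nlinarith [mul_le_mul h0 h0 hβ.le (hβ.le.trans h0)]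
  have hdiff : ‖(y m - y j') - B (mv (tsub c (tsub lam' lam)))‖ ≤ (D + 1 / 10 ^ 4 * nearestDist y j + τ) + D' := by
    have e : (y m - y j') - B (mv (tsub c (tsub lam' lam))) = (y m - y i - B (mv (tadd lam c))) - (y j' - y i - B (mv lam')) := by
      rw [← ht, mv_tsub, mv_tadd, map_sub, map_add]; abel
    rw [e]
    exact (norm_sub_le _ _).trans (add_le_add hposm hE'.2.2)
  have hn1 : ‖mv (tsub c (tsub lam' lam))‖ = 1 := (norm_mv_eq_one_iff _).2 hce
  have hmj' : m ≠ j' := by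
    intro hmm
    rw [hmm, sub_self, zero_sub, norm_neg] at hdiff
    have h1 := hB (mv (tsub c (tsub lam' lam)))
    rw [hn1, mul_one] at h1
    linarith
  have hreach' : dist (y m) (y j') ≤ (3 / 2 + 1 / 450) * nearestDist y j' := by
    rw [dist_eq_norm]
    have e : y m - y j' = ((y m - y j') - B (mv (tsub c (tsub lam' lam)))) + B (mv (tsub c (tsub lam' lam))) := by abel
    rw [e]
    have h1 := hBup (mv (tsub c (tsub lam' lam)))
    rw [hn1, mul_one] at h1
    exact (norm_add_le _ _).trans (by linarith)
  have key := label_mem hP hf hex hj hj' hB hβ hE hE' hv hv1 hMv hm.symm hmj' hreach' (g := 6) (by rw [ht]; exact hgran)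
    (by exact_mod_cast hgap)
  rw [ht] at key
  exact key.1

/-- ★★ **COPY AGREEMENT OF ADJACENT SITES.**  Two established sites of one layer — labels differing by a basal vector `e ∈ hexL` — whose copies are among the
four aligned copies, under the reach and resolution conditions of `cap_child_label`, carry the SAME copy. [this file] -/
theorem copy_eq_of_adjacent {y : Fin N → EuclideanSpace ℝ (Fin 3)} {r : ℝ} {i j j' : Fin N}
    {A : Fin N → (EuclideanSpace ℝ (Fin 3) →ₗ[ℝ] EuclideanSpace ℝ (Fin 3))} {P : Fin N → Finset (EuclideanSpace ℝ (Fin 3))}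
    {f : Fin N → EuclideanSpace ℝ (Fin 3) → EuclideanSpace ℝ (Fin 3)} {B : EuclideanSpace ℝ (Fin 3) →ₗ[ℝ] EuclideanSpace ℝ (Fin 3)} {β γ : ℝ}
    (hP : ∀ j, dist (y j) (y i) ≤ r → (P j = fccTwoShellPattern ∨ P j = hcpTwoShellPattern))
    (hf : ∀ j, dist (y j) (y i) ≤ r → ∀ v ∈ P j, f j v ∈ Set.range y ∧ dist (f j v) (y j + nearestDist y j • A j v) ≤ 1 / 10 ^ 4 * nearestDist y j)
    (hex : ∀ j, dist (y j) (y i) ≤ r → ∀ m, m ≠ j → dist (y m) (y j) ≤ (3 / 2 + 1 / 450) * nearestDist y j → ∃ v ∈ P j, f j v = y m)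
    (hj : dist (y j) (y i) ≤ r) (hj' : dist (y j') (y i) ≤ r) (hB : ∀ z, β * ‖z‖ ≤ ‖B z‖) (hβ : 0 < β) (hBup : ∀ z, ‖B z‖ ≤ γ * ‖z‖)
    {M M' : EuclideanSpace ℝ (Fin 3) →ₗᵢ[ℝ] EuclideanSpace ℝ (Fin 3)} {C C' : List T3} {lam lam' : T3} {τ τ' D D' : ℝ}
    (hE : Estab y A P B i j M C lam τ D) (hE' : Estab y A P B i j' M' C' lam' τ' D')
    (hC : C ∈ [fccL, fccNegL, hcpL, hcpAltL]) (hC' : C' ∈ [fccL, fccNegL, hcpL, hcpAltL]) (he : tsub lam' lam ∈ hexL)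
    (hreach : γ + (D + 1 / 10 ^ 4 * nearestDist y j + τ) + D' ≤ (3 / 2 + 1 / 450) * nearestDist y j')
    (hgap : 18 * ((D + 1 / 10 ^ 4 * nearestDist y j + τ) + (D' + 1 / 10 ^ 4 * nearestDist y j' + Real.sqrt 2 * τ')) ^ 2 < 6 * β ^ 2) :
    C' = C := by
  obtain ⟨cp, hcp, cm, hcm, hpe, hme, hpin⟩ := pin_table C hC _ he
  obtain ⟨hcpC, hcp18, -⟩ := mem_capL.1 hcp
  obtain ⟨hcmC, hcm18, -⟩ := mem_capL.1 hcm
  exact hpin C' hC' (cap_child_label hP hf hex hj hj' hB hβ hBup hE hE' hcpC hcp18 hpe (gran_table C hC cp hcpC hcp18 _ he hpe C' hC') hreach hgap)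
    (cap_child_label hP hf hex hj hj' hB hβ hBup hE hE' hcmC hcm18 hme (gran_table C hC cm hcmC hcm18 _ he hme C' hC') hreach hgap)

/-! ## §3  The copy determines the type -/

/-- `F⁺` and `F⁻` are centrally symmetric (by `decide`). [this file] -/
theorem symm_fcc : (∀ V ∈ fccL, tneg V ∈ fccL) ∧ (∀ V ∈ fccNegL, tneg V ∈ fccNegL) := by decide

/-- `H` and `H′` are not centrally symmetric (by `decide`). [this file] -/
theorem not_symm_hcp : ¬ (∀ V ∈ hcpL, tneg V ∈ hcpL) ∧ ¬ (∀ V ∈ hcpAltL, tneg V ∈ hcpAltL) := by decide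

/-- A chart transports central symmetry from the listing model to the copy. [this file] -/
theorem carries_symm_of_listed {M : EuclideanSpace ℝ (Fin 3) →ₗᵢ[ℝ] EuclideanSpace ℝ (Fin 3)} {P : Finset (EuclideanSpace ℝ (Fin 3))} {S C : List T3}
    (hL : ListedBy P S) (hS : ∀ W ∈ S, tneg W ∈ S) (hM : Carries M P C) : ∀ V ∈ C, tneg V ∈ C := by
  intro V hV
  obtain ⟨v, hv, hMv⟩ := hM.2 V hV
  obtain ⟨W, hW, hvW⟩ := hL.1 v hv
  have hnv : -v ∈ P := by
    rw [hvW, ← mv_tneg]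
    exact hL.2 _ (hS W hW)
  obtain ⟨V', hV', hMV'⟩ := hM.1 (-v) hnv
  have h : V' = tneg V := mv_injective (by rw [← hMV', map_neg, hMv, mv_tneg])
  rw [← h]
  exact hV'

/-- A chart transports central symmetry from the copy back to the listing model. [this file] -/
theorem listed_symm_of_carries {M : EuclideanSpace ℝ (Fin 3) →ₗᵢ[ℝ] EuclideanSpace ℝ (Fin 3)} {P : Finset (EuclideanSpace ℝ (Fin 3))} {S C : List T3}
    (hL : ListedBy P S) (hC : ∀ V ∈ C, tneg V ∈ C) (hM : Carries M P C) : ∀ W ∈ S, tneg W ∈ S := by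
  intro W hW
  obtain ⟨V, hV, hMV⟩ := hM.1 _ (hL.2 W hW)
  obtain ⟨v', hv', hMv'⟩ := hM.2 _ (hC V hV)
  have hv'eq : v' = -mv W := M.injective (by rw [hMv', map_neg, hMV, mv_tneg])
  have hnW : mv (tneg W) ∈ P := by
    rw [mv_tneg, ← hv'eq]
    exact hv'
  obtain ⟨W', hW', hWW'⟩ := hL.1 _ hnW
  rw [mv_injective hWW']
  exact hW'

/-- ★ A pattern carried onto `H` or `H′` is the hcp pattern. [this file] -/
theorem type_hcp_of_copy {P : Finset (EuclideanSpace ℝ (Fin 3))} (hP : P = fccTwoShellPattern ∨ P = hcpTwoShellPattern)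
    {M : EuclideanSpace ℝ (Fin 3) →ₗᵢ[ℝ] EuclideanSpace ℝ (Fin 3)} {C : List T3} (hC : C = hcpL ∨ C = hcpAltL) (hM : Carries M P C) :
    P = hcpTwoShellPattern := by
  rcases hP with hP | hP
  · exfalso
    have hL : ListedBy P fccL := by rw [hP]; exact listedBy_fcc
    have h := carries_symm_of_listed hL symm_fcc.1 hM
    rcases hC with rfl | rfl
    · exact not_symm_hcp.1 h
    · exact not_symm_hcp.2 h
  · exact hP

/-- ★ A pattern carried onto `F⁺` or `F⁻` is the fcc pattern. [this file] -/
theorem type_fcc_of_copy {P : Finset (EuclideanSpace ℝ (Fin 3))} (hP : P = fccTwoShellPattern ∨ P = hcpTwoShellPattern)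
    {M : EuclideanSpace ℝ (Fin 3) →ₗᵢ[ℝ] EuclideanSpace ℝ (Fin 3)} {C : List T3} (hC : C = fccL ∨ C = fccNegL) (hM : Carries M P C) :
    P = fccTwoShellPattern := by
  rcases hP with hP | hP
  · exact hP
  · exfalso
    have hL : ListedBy P hcpL := by rw [hP]; exact listedBy_hcp
    have hCs : ∀ V ∈ C, tneg V ∈ C := by
      rcases hC with rfl | rfl
      · exact symm_fcc.1
      · exact symm_fcc.2
    exact not_symm_hcp.1 (listed_symm_of_carries hL hCs hM)

end Summit.AtomisticToContinuum.Crystallization.Theorems.OverbindingBudgetAffineCompressedCutStack
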